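import Mathlib.NumberTheory.DirichletCharacter.Basic
import Mathlib.NumberTheory.MulChar.Duality
import Mathlib.RingTheory.RootsOfUnity.AlgebraicallyClosed
import Mathlib.Analysis.Complex.Polynomial.Basic
import Mathlib.Data.ZMod.Units
import HarnessLib

/-!
# Existence of primitive Dirichlet characters of squareful level

For every `c ≥ 1` all of whose prime factors occur at least to the second power
(`p ∣ c ⇒ p² ∣ c`; e.g. `c = N²`) there is a **primitive** Dirichlet character `χ` modulo `c` with
values in `ℂ` (`exists_isPrimitive_of_sq_dvd`, `exists_isPrimitive_sq`).  (A primitive character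
modulo `c` exists iff `c ≢ 2 (mod 4)`; the squareful case is the one needed for twisting modular
forms of level `N` by a primitive character whose conductor is a multiple of `N`, where `c = N²`
will do.)

Construction: for each prime `p ∣ c` the element `u_p = 1 + c/p` is a unit modulo `c`, congruent
to `1` modulo `c/p` and modulo `q^{v_q(c)}` for every prime `q ≠ p`, but not modulo `p^{v_p(c)}`.
By duality for the finite abelian group `(ℤ/p^{v_p(c)})ˣ` (Mathlib
`MulChar.exists_apply_ne_one_of_hasEnoughRootsOfUnity`) there is a character `ψ_p` modulo
`p^{v_p(c)}` with `ψ_p(u_p) ≠ 1`; the product `χ = ∏_p ψ_p` (each lifted to level `c`) then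
satisfies `χ(u_p) = ψ_p(u_p) ≠ 1` for every `p`, so `χ` factors through no `c/p`, i.e. `χ` is
primitive (Mathlib `DirichletCharacter.factorsThrough_iff_ker_unitsMap`).

Everything is proved; there are no named facts.

## References

* H. Davenport, *Multiplicative number theory*, 3rd ed., GTM 74 (2000), Ch. 5 (primitive
  characters).
-/

noncomputable section

open DirichletCharacter

namespace Literature.NumberTheory.EllipticCurves.ModularForms

namespace PrimitiveCharacterExists

variable {c : ℕ}

/-! ### The units `u_p = 1 + c/p` -/

/-- For `p² ∣ c`, every prime factor of `c` divides `c/p`. [folklore] -/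
theorem dvd_div_of_prime_dvd {p : ℕ} (hp : p.Prime) (hp2 : p ^ 2 ∣ c) {k : ℕ} (hk : k.Prime)
    (hkc : k ∣ c) : k ∣ c / p := by
  have hpc : p ∣ c := dvd_trans (dvd_pow_self p two_ne_zero) hp2
  by_cases hkp : k = p
  · subst hkp
    exact Nat.dvd_div_of_mul_dvd (by simpa [sq] using hp2)
  · have hcop : Nat.Coprime k p := (Nat.coprime_primes hk hp).mpr hkp
    have : k ∣ p * (c / p) := by rw [Nat.mul_div_cancel' hpc]; exact hkc
    exact hcop.dvd_mul_left.mp this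

/-- `1 + c/p` is coprime to `c` when `p² ∣ c`. [folklore] -/
theorem coprime_one_add_div {p : ℕ} (hp : p.Prime) (hp2 : p ^ 2 ∣ c) :
    Nat.Coprime (1 + c / p) c := by
  refine Nat.coprime_of_dvd fun k hk hk1 hkc ↦ ?_
  have h2 : k ∣ c / p := dvd_div_of_prime_dvd hp hp2 hk hkc
  have : k ∣ 1 := by simpa using (Nat.dvd_sub hk1 h2)
  exact hk.one_lt.ne' (Nat.dvd_one.mp this)

/-- The unit `u_p = 1 + c/p ∈ (ℤ/c)ˣ`. [folklore] -/
def unitAt {p : ℕ} (hp : p.Prime) (hp2 : p ^ 2 ∣ c) : (ZMod c)ˣ :=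
  ZMod.unitOfCoprime (1 + c / p) (coprime_one_add_div hp hp2)

/-- The value of `u_p` in `ℤ/c`. [folklore] -/
@[simp] theorem coe_unitAt {p : ℕ} (hp : p.Prime) (hp2 : p ^ 2 ∣ c) :
    ((unitAt hp hp2 : (ZMod c)ˣ) : ZMod c) = ((1 + c / p : ℕ) : ZMod c) :=
  ZMod.coe_unitOfCoprime _ _

/-- Reduction of `u_p` modulo a divisor `m` of `c/p` is `1`. [folklore] -/
theorem unitsMap_unitAt_eq_one {p : ℕ} (hp : p.Prime) (hp2 : p ^ 2 ∣ c) {m : ℕ} (hm : m ∣ c)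
    (hmp : m ∣ c / p) : ZMod.unitsMap hm (unitAt hp hp2) = 1 := by
  apply Units.ext
  rw [ZMod.unitsMap_val, coe_unitAt, ZMod.cast_natCast hm, Units.val_one, Nat.cast_add,
    Nat.cast_one, (ZMod.natCast_eq_zero_iff _ _).mpr hmp, add_zero]

/-- Reduction of `u_p` modulo `p^{v_p(c)}` is not `1`. [folklore] -/
theorem unitsMap_unitAt_ne_one (hc : c ≠ 0) {p : ℕ} (hp : p.Prime) (hp2 : p ^ 2 ∣ c) :
    ZMod.unitsMap (Nat.ordProj_dvd c p) (unitAt hp hp2) ≠ 1 := by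
  intro h
  have h' : ((ZMod.unitsMap (Nat.ordProj_dvd c p) (unitAt hp hp2) : (ZMod (p ^ c.factorization p))ˣ) :
      ZMod (p ^ c.factorization p)) = 1 := by rw [h, Units.val_one]
  rw [ZMod.unitsMap_val, coe_unitAt, ZMod.cast_natCast (Nat.ordProj_dvd c p),
    Nat.cast_add, Nat.cast_one, add_eq_left, ZMod.natCast_eq_zero_iff] at h'
  have hpc : p ∣ c := dvd_trans (dvd_pow_self p two_ne_zero) hp2
  have : p ^ (c.factorization p + 1) ∣ c := by
    rw [pow_succ']
    exact Nat.mul_dvd_of_dvd_div hpc h'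
  exact Nat.pow_succ_factorization_not_dvd hc hp this

/-! ### Local characters detecting `u_p` -/

/-- **A character modulo `p^{v_p(c)}` that is non-trivial at `u_p`** (duality for finite abelian
groups, Mathlib `MulChar.exists_apply_ne_one_of_hasEnoughRootsOfUnity`). [folklore] -/
theorem exists_local_char (hc : c ≠ 0) {p : ℕ} (hp : p.Prime) (hp2 : p ^ 2 ∣ c) :
    ∃ ψ : DirichletCharacter ℂ (p ^ c.factorization p),
      ψ (ZMod.unitsMap (Nat.ordProj_dvd c p) (unitAt hp hp2) : (ZMod (p ^ c.factorization p))ˣ) ≠ 1 := by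
  haveI : NeZero (p ^ c.factorization p) := ⟨pow_ne_zero _ hp.ne_zero⟩
  haveI : NeZero (Monoid.exponent (ZMod (p ^ c.factorization p))ˣ) :=
    ⟨Monoid.exponent_ne_zero_of_finite⟩
  have hne : ((ZMod.unitsMap (Nat.ordProj_dvd c p) (unitAt hp hp2) : (ZMod (p ^ c.factorization p))ˣ) :
      ZMod (p ^ c.factorization p)) ≠ 1 := by
    intro h
    exact unitsMap_unitAt_ne_one hc hp hp2 (Units.ext (by rw [h, Units.val_one]))
  exact MulChar.exists_apply_ne_one_of_hasEnoughRootsOfUnity (ZMod (p ^ c.factorization p)) ℂ hne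

/-- The local character at `p`, lifted to level `c` (and `1` off the prime factors of `c`). [folklore] -/
def localChar (hc : c ≠ 0) (hsq : ∀ p : ℕ, p.Prime → p ∣ c → p ^ 2 ∣ c) (p : ℕ) :
    DirichletCharacter ℂ c :=
  if h : p.Prime ∧ p ∣ c then
    changeLevel (Nat.ordProj_dvd c p) (Classical.choose (exists_local_char hc h.1 (hsq p h.1 h.2)))
  else 1

/-- **The local character at `p` detects `u_p`.** [folklore] -/
theorem localChar_apply_self (hc : c ≠ 0) (hsq : ∀ p : ℕ, p.Prime → p ∣ c → p ^ 2 ∣ c) {p : ℕ}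
    (hp : p.Prime) (hpc : p ∣ c) :
    localChar hc hsq p (unitAt hp (hsq p hp hpc) : (ZMod c)ˣ) ≠ 1 := by
  rw [localChar, dif_pos ⟨hp, hpc⟩, changeLevel_eq_cast_of_dvd, ← ZMod.unitsMap_val (Nat.ordProj_dvd c p)]
  exact Classical.choose_spec (exists_local_char hc hp (hsq p hp hpc))

/-- **The local character at `q` is trivial at `u_p` for `p ≠ q`** (`u_p ≡ 1 mod q^{v_q(c)}`).
[folklore] -/
theorem localChar_apply_other (hc : c ≠ 0) (hsq : ∀ p : ℕ, p.Prime → p ∣ c → p ^ 2 ∣ c) {p : ℕ}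
    (hp : p.Prime) (hpc : p ∣ c) {q : ℕ} (hqp : q ≠ p) :
    localChar hc hsq q (unitAt hp (hsq p hp hpc) : (ZMod c)ˣ) = 1 := by
  rw [localChar]
  split_ifs with hq
  · -- `q^{v_q(c)} ∣ c/p`
    have hcop : Nat.Coprime (q ^ c.factorization q) p :=
      Nat.Coprime.pow_left _ ((Nat.coprime_primes hq.1 hp).mpr hqp)
    have hmul : q ^ c.factorization q * p ∣ c :=
      Nat.Coprime.mul_dvd_of_dvd_of_dvd hcop (Nat.ordProj_dvd c q) hpc
    have hdiv : q ^ c.factorization q ∣ c / p :=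
      Nat.dvd_div_of_mul_dvd (by rwa [mul_comm] at hmul)
    rw [changeLevel_eq_cast_of_dvd, ← ZMod.unitsMap_val (Nat.ordProj_dvd c q),
      unitsMap_unitAt_eq_one hp (hsq p hp hpc) (Nat.ordProj_dvd c q) hdiv, Units.val_one, map_one]
  · exact MulChar.one_apply_coe _

/-! ### The global character -/

/-- Evaluation of a finite product of multiplicative characters at a unit. [folklore] -/
theorem prod_apply_coe {ι : Type*} (S : Finset ι) (χ : ι → DirichletCharacter ℂ c) (u : (ZMod c)ˣ) :
    (∏ i ∈ S, χ i) (u : ZMod c) = ∏ i ∈ S, χ i (u : ZMod c) := by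
  classical
  induction S using Finset.induction_on with
  | empty => simp [MulChar.one_apply_coe]
  | insert i S hi ih => rw [Finset.prod_insert hi, Finset.prod_insert hi, MulChar.coeToFun_mul,
      Pi.mul_apply, ih]

/-- **The global character** `χ = ∏_{p ∣ c} ψ_p`. [folklore] -/
def globalChar (hc : c ≠ 0) (hsq : ∀ p : ℕ, p.Prime → p ∣ c → p ^ 2 ∣ c) : DirichletCharacter ℂ c :=
  ∏ p ∈ c.primeFactors, localChar hc hsq p

/-- **`χ(u_p) ≠ 1` for every prime `p ∣ c`.** [folklore] -/
theorem globalChar_apply_unitAt (hc : c ≠ 0) (hsq : ∀ p : ℕ, p.Prime → p ∣ c → p ^ 2 ∣ c) {p : ℕ}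
    (hp : p.Prime) (hpc : p ∣ c) :
    globalChar hc hsq (unitAt hp (hsq p hp hpc) : (ZMod c)ˣ) ≠ 1 := by
  have hmem : p ∈ c.primeFactors := Nat.mem_primeFactors.mpr ⟨hp, hpc, hc⟩
  rw [globalChar, prod_apply_coe, ← Finset.mul_prod_erase _ _ hmem,
    Finset.prod_eq_one (fun q hq ↦ localChar_apply_other hc hsq hp hpc (Finset.ne_of_mem_erase hq)),
    mul_one]
  exact localChar_apply_self hc hsq hp hpc

/-- **The global character is primitive**: if its conductor `d` were a proper divisor of `c`,
then `d ∣ c/p` for some prime `p ∣ c`, so `χ` would factor through `c/p` and kill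
`u_p ∈ ker((ℤ/c)ˣ → (ℤ/(c/p))ˣ)` (Mathlib `factorsThrough_iff_ker_unitsMap`). [folklore] -/
theorem isPrimitive_globalChar (hc : c ≠ 0) (hsq : ∀ p : ℕ, p.Prime → p ∣ c → p ^ 2 ∣ c) :
    (globalChar hc hsq).IsPrimitive := by
  haveI : NeZero c := ⟨hc⟩
  set χ := globalChar hc hsq with hχ
  rw [isPrimitive_def]
  by_contra hne
  set d := χ.conductor with hd
  have hdc : d ∣ c := conductor_dvd_level χ
  have hd0 : d ≠ 0 := conductor_ne_zero χ
  -- a prime `p ∣ c/d`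
  have hcd : 1 < c / d := by
    obtain ⟨k, hk⟩ := hdc
    have hk1 : k ≠ 1 := fun h ↦ hne (by rw [hk, h, mul_one])
    have hk0 : k ≠ 0 := fun h ↦ hc (by rw [hk, h, mul_zero])
    rw [hk, Nat.mul_div_cancel_left k (Nat.pos_of_ne_zero hd0)]
    omega
  obtain ⟨p, hp, hpcd⟩ := Nat.exists_prime_and_dvd hcd.ne'
  have hdp : d * p ∣ c := Nat.mul_dvd_of_dvd_div hdc hpcd
  have hpc : p ∣ c := dvd_trans (dvd_mul_left p d) hdp
  have hdcp : d ∣ c / p := Nat.dvd_div_of_mul_dvd (by rwa [mul_comm] at hdp)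
  have hcpc : c / p ∣ c := Nat.div_dvd_of_dvd hpc
  -- `χ` factors through `c/p`
  have hfac : FactorsThrough χ (c / p) := FactorsThrough.mono χ (factorsThrough_conductor χ) hdcp hcpc
  have hker := (factorsThrough_iff_ker_unitsMap hcpc).mp hfac
  -- but `u_p` is in the kernel of the reduction and `χ(u_p) ≠ 1`
  have hu : unitAt hp (hsq p hp hpc) ∈ (ZMod.unitsMap hcpc).ker := by
    rw [MonoidHom.mem_ker]
    exact unitsMap_unitAt_eq_one hp (hsq p hp hpc) hcpc dvd_rfl
  have h1 := hker hu
  rw [MonoidHom.mem_ker, Units.ext_iff, MulChar.coe_toUnitHom, Units.val_one] at h1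
  exact globalChar_apply_unitAt hc hsq hp hpc h1

end PrimitiveCharacterExists

open PrimitiveCharacterExists in
/-- **Primitive characters of squareful level exist**: if every prime factor of `c ≠ 0` divides
`c` at least twice, there is a primitive Dirichlet character modulo `c`. [folklore] -/
theorem exists_isPrimitive_of_sq_dvd {c : ℕ} (hc : c ≠ 0)
    (hsq : ∀ p : ℕ, p.Prime → p ∣ c → p ^ 2 ∣ c) :
    ∃ χ : DirichletCharacter ℂ c, χ.IsPrimitive :=
  ⟨globalChar hc hsq, isPrimitive_globalChar hc hsq⟩

/-- **A primitive Dirichlet character modulo `N²` exists** for every `N ≥ 1`. [folklore] -/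
theorem exists_isPrimitive_sq (N : ℕ) [NeZero N] :
    ∃ χ : DirichletCharacter ℂ (N ^ 2), χ.IsPrimitive := by
  refine exists_isPrimitive_of_sq_dvd (pow_ne_zero 2 (NeZero.ne N)) fun p hp hpN ↦ ?_
  exact pow_dvd_pow_of_dvd (hp.dvd_of_dvd_pow hpN) 2

end Literature.NumberTheory.EllipticCurves.ModularForms
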